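import Literature.IUT.LogVolume.PrincipalArithmeticDivisors
import Literature.IUT.LogVolume.IdealArithmeticDivisors
import Literature.IUT.LogVolume.ArithmeticDivisorsFrdBridge
import Mathlib.NumberTheory.NumberField.Units.DirichletTheorem
import Mathlib.NumberTheory.NumberField.ClassNumber
import HarnessLib

/-!
# Real arithmetic divisors of degree zero are `ℝ`-linear combinations of principal divisors
# ([FrdI] Thm. 6.4 (i): "`δ_A : Pic_Φ(A) ⥲ ℝ` … by the well-known Dirichlet unit theorem")

Mochizuki, *The geometry of Frobenioids I*, Kyushu J. Math. **62** (2008), Theorem 6.4 (i), last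
assertion, kurims text p. 114 (statement) and p. 115 l. 27–33 (proof): for the arithmetic Frobenioid
`C` of Example 6.3 and a Frobenius-trivial object `A ∈ Ob(C^rlf)` over `Spec L`, "the natural surjection
`(Φ^rlf)^gp(A) ↠ Pic_Φ(A)` [of Theorem 5.1 (i)], together with the homomorphism of realified arithmetic
degree `(Φ^rlf)^gp(A) → ℝ`, determine an isomorphism of groups `δ_A : Pic_Φ(A) ⥲ ℝ`"; in the proof:
"That `δ_A` is surjective is a formal consequence of our definition of arithmetic divisors and their
degrees" and "That `δ_A` is injective follows from the fact that […] the image of `Φ^birat(L)` in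
`Φ^rlf_factor(L)` `⊆ (Φ^rlf_factor)^gp(L)`, where we take the factorization homomorphism to be the
arithmetic degree map, is equal to the set of elements of *finite support* with arithmetic degree `0` —
a consequence of the well-known Dirichlet unit theorem". [cite: MochizukiFrdI2008, Thm. 6.4 (i) p.114]

Here `(Φ^rlf)^gp(L)` — real arithmetic divisors on `L` — is the tree's `ADiv_ℝ(L) = ADivisor L`
(`Literature.IUT.LogVolume`, bridged to [FrdI] Ex. 6.3's `Φ(L)^gp` by `ArithmeticDivisorsFrdBridge`),
the realified arithmetic degree is `degF L` and the image of `Φ^birat(L) = L^×` is `APrc L` (the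
principal divisors `ADiv(f)`). This PROOF-ONLY file kernel-checks the two classical number-theoretic
contents of the sentence above, over Mathlib number fields (sub-nodes T64i/L13, T64i/L14 of the cell's
sub-DAG for Thm. 6.4):

* `degF_surjective` — `deg_L : ADiv_ℝ(L) → ℝ` is onto ("surjective … formally");
* `mem_span_APrc_of_degF_eq_zero` / `span_APrc_eq_ker_degF` — **the `ℝ`-span of the principal divisors
  is exactly the kernel of `deg_L`** (so `ADiv_ℝ(L) / ℝ·APrc(L) ≅ ℝ` via `deg_L`): `⊇` is the product
  formula (`APrc_le_ker_degF`, landed); `⊆` is proved from (a) the finiteness of the ideal class group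
  (Mathlib `instFintypeClassGroup`: `𝔭^h = (x)` removes the nonarchimedean part modulo `ℚ·ADiv(x)`) and
  (b) the Dirichlet unit theorem in Mathlib's form `NumberField.Units.unitLattice_span_eq_top` (the
  logarithmic embeddings of the units span the trace-zero hyperplane over `ℝ`).

Classical algebraic number theory; nothing here is specific to, or takes a side on, the disputed corpus.
-/

noncomputable section

namespace Literature.IUT.LogVolume

open NumberField IsDedekindDomain Finset NumberField.Units NumberField.InfinitePlace
open NumberField.Units.dirichletUnitTheorem

variable (F : Type*) [Field F] [NumberField F]

/-! ### Surjectivity of the degree -/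

/-- `deg_F : ADiv_ℝ(F) → ℝ` is surjective: `deg_F(c·v) = c` for any archimedean `v`
([FrdI] Thm. 6.4 (i), proof p. 115: "That `δ_A` is surjective is a formal consequence of our definition
of arithmetic divisors and their degrees"). [cite: MochizukiFrdI2008, Thm. 6.4 (i) p.115] -/
theorem degF_surjective : Function.Surjective (degF F) := fun c =>
  ⟨ADivisor.of (Sum.inl w₀) c, degF_of_inl F w₀ c⟩

/-! ### Principal divisors of units and of generators of `𝔭^h` -/

variable {F}

/-- A unit of `O_F` has `ord_v = 0` at every finite place. [cite: MochizukiFrdI2008, Ex. 6.3 p.113] -/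
theorem ord_coe_unit (v : HeightOneSpectrum (𝓞 F)) (u : (𝓞 F)ˣ) : ord F v (u : F) = 0 := by
  have h1 : 0 ≤ ord F v (u : F) := ord_nonneg_of_isIntegral F v u
  have h2 : 0 ≤ ord F v ((u⁻¹ : (𝓞 F)ˣ) : F) := ord_nonneg_of_isIntegral F v _
  have h := ord_mul F v (NumberField.Units.coe_ne_zero u) (NumberField.Units.coe_ne_zero u⁻¹)
  rw [← NumberField.Units.coe_mul, mul_inv_cancel, NumberField.Units.coe_one, ord_one] at h
  omega

/-- The principal divisor of a unit has no nonarchimedean part. [cite: MochizukiFrdI2008, Ex. 6.3 p.113] -/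
theorem principal_coe_unit_apply_inr (u : (𝓞 F)ˣ) (v : HeightOneSpectrum (𝓞 F)) :
    ADivisor.principal (u : F) (Sum.inr v) = 0 := by
  rw [ADivisor.principal_apply_inr, ord_coe_unit, Int.cast_zero]

/-- The principal divisor of a unit at an archimedean place is minus its logarithmic embedding.
[cite: MochizukiFrdI2008, Ex. 6.3 p.113] -/
theorem principal_coe_unit_apply_inl (u : (𝓞 F)ˣ) (w : InfinitePlace F) :
    ADivisor.principal (u : F) (Sum.inl w) = -((w.mult : ℝ) * Real.log (w (u : F))) :=
  ADivisor.principal_apply_inl _ _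

open scoped Classical in
/-- **Finiteness of the class group, divisor form**: for every finite place `v` there are `h ≥ 1` and
`x ∈ O_F ∖ 0` with `𝔭_v^h = (x)`, i.e. the nonarchimedean part of `ADiv(x)` is `h·v`.
[cite: MochizukiFrdI2008, Thm. 6.4 (i) p.115] -/
theorem exists_principal_apply_inr_eq_single (v : HeightOneSpectrum (𝓞 F)) :
    ∃ (h : ℕ) (x : 𝓞 F), 0 < h ∧ x ≠ 0 ∧
      ∀ v' : HeightOneSpectrum (𝓞 F),
        ADivisor.principal (x : F) (Sum.inr v') = if v' = v then (h : ℝ) else 0 := by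
  classical
  set h := Fintype.card (ClassGroup (𝓞 F)) with hh
  have hpow : v.asIdeal ^ h ≠ ⊥ := pow_ne_zero _ v.ne_bot
  have hI : v.asIdeal ^ h ∈ nonZeroDivisors (Ideal (𝓞 F)) := mem_nonZeroDivisors_of_ne_zero hpow
  have hv : v.asIdeal ∈ nonZeroDivisors (Ideal (𝓞 F)) := mem_nonZeroDivisors_of_ne_zero v.ne_bot
  have h1 : ClassGroup.mk0 ⟨v.asIdeal ^ h, hI⟩ = 1 := by
    have : (⟨v.asIdeal ^ h, hI⟩ : nonZeroDivisors (Ideal (𝓞 F))) = ⟨v.asIdeal, hv⟩ ^ h := by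
      ext; simp
    rw [this, map_pow]
    exact pow_card_eq_one
  haveI : (v.asIdeal ^ h).IsPrincipal := (ClassGroup.mk0_eq_one_iff hI).mp h1
  obtain ⟨x, hx⟩ := Submodule.IsPrincipal.principal (v.asIdeal ^ h)
  have hx0 : x ≠ 0 := by
    rintro rfl
    apply hpow
    rw [hx]
    simp
  refine ⟨h, x, Fintype.card_pos, hx0, fun v' => ?_⟩
  have hsx : Ideal.span {x} = v.asIdeal ^ h := hx.symm
  rw [← ADivisor.ofIdeal_span_singleton_apply_inr hx0 v', hsx, ADivisor.ofIdeal_apply_inr hpow]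
  by_cases hv' : v' = v
  · subst hv'
    rw [if_pos rfl, multiplicity_pow_self_of_prime v'.prime]
  · rw [if_neg hv', Nat.cast_eq_zero, multiplicity_eq_zero]
    intro hdvd
    apply hv'
    have hle : v.asIdeal ≤ v'.asIdeal := Ideal.le_of_dvd (v'.prime.dvd_of_dvd_pow hdvd)
    have := (v.isMaximal.eq_of_le v'.isPrime.ne_top hle)
    exact HeightOneSpectrum.ext this.symm

/-! ### The degree of a divisor with no nonarchimedean part -/

/-- If `a ∈ ADiv_ℝ(F)` has no nonarchimedean part then `deg_F(a) = Σ_{v|∞} a_v` (`deg_F(v) = 1` there).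
[cite: MochizukiFrdI2008, Ex. 6.3 p.113] -/
theorem degF_eq_sum_inl_of_inr_eq_zero (a : ADivisor F) (ha : ∀ v, a (Sum.inr v) = 0) :
    degF F a = ∑ w : InfinitePlace F, a (Sum.inl w) := by
  classical
  rw [degF_apply, Finsupp.sum]
  have hsub : a.support ⊆ (Finset.univ : Finset (InfinitePlace F)).map ⟨Sum.inl, Sum.inl_injective⟩ := by
    intro p hp
    rw [Finsupp.mem_support_iff] at hp
    rcases p with w | v
    · exact Finset.mem_map.mpr ⟨w, Finset.mem_univ _, rfl⟩
    · exact (hp (ha v)).elim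
  rw [Finset.sum_subset hsub (fun p _ hp => by rw [Finsupp.notMem_support_iff.mp hp, zero_mul]),
    Finset.sum_map]
  refine Finset.sum_congr rfl fun w _ => ?_
  change a (Sum.inl w) * degWeight F (Sum.inl w) = _
  rw [degWeight_inl, mul_one]

/-- A divisor with no nonarchimedean part, degree `0`, and vanishing coordinates at all archimedean
`w ≠ w₀` is zero. [cite: MochizukiFrdI2008, Thm. 6.4 (i) p.115] -/
theorem eq_zero_of_inr_eq_zero_of_degF_eq_zero (a : ADivisor F) (ha : ∀ v, a (Sum.inr v) = 0)
    (hdeg : degF F a = 0) (hw : ∀ w : InfinitePlace F, w ≠ w₀ → a (Sum.inl w) = 0) : a = 0 := by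
  classical
  have h0 : a (Sum.inl w₀) = 0 := by
    rw [degF_eq_sum_inl_of_inr_eq_zero a ha, Fintype.sum_eq_add_sum_subtype_ne _ w₀] at hdeg
    rw [Finset.sum_eq_zero (fun (w : {w // w ≠ w₀}) _ => hw w.1 w.2), add_zero] at hdeg
    exact hdeg
  ext (w | v)
  · by_cases h : w = w₀
    · subst h; simpa using h0
    · simpa using hw w h
  · simpa using ha v

/-! ### The Dirichlet step: archimedean divisors of degree `0` -/

/-- **Dirichlet unit theorem step**: a real arithmetic divisor with no nonarchimedean part and degree
`0` is an `ℝ`-linear combination of principal divisors of units ([FrdI] Thm. 6.4 (i), proof p. 115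
l. 28–32). [cite: MochizukiFrdI2008, Thm. 6.4 (i) p.115] -/
theorem mem_span_APrc_of_inr_eq_zero (a : ADivisor F) (ha : ∀ v, a (Sum.inr v) = 0)
    (hdeg : degF F a = 0) :
    a ∈ Submodule.span ℝ ((APrc F : AddSubgroup (ADivisor F)) : Set (ADivisor F)) := by
  classical
  -- the archimedean coordinates `(−a_w)_{w ≠ w₀}` lie in the real span of the unit lattice
  let g : logSpace F := fun w => -a (Sum.inl w.1)
  have hg : g ∈ Submodule.span ℝ (unitLattice F : Set (logSpace F)) := by
    rw [unitLattice_span_eq_top]; trivial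
  -- every vector of that span is realised by a divisor in the span of the principal divisors,
  -- with no nonarchimedean part and degree zero
  have key : ∀ g' : logSpace F, g' ∈ Submodule.span ℝ (unitLattice F : Set (logSpace F)) →
      ∃ s : ADivisor F, s ∈ Submodule.span ℝ ((APrc F : AddSubgroup (ADivisor F)) : Set (ADivisor F)) ∧
        (∀ v, s (Sum.inr v) = 0) ∧ degF F s = 0 ∧ ∀ w : {w : InfinitePlace F // w ≠ w₀},
          -s (Sum.inl w.1) = g' w := by
    intro g' hg'
    induction hg' using Submodule.span_induction with
    | mem x hx =>
      obtain ⟨y, -, rfl⟩ := Submodule.mem_map.mp hx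
      set u : (𝓞 F)ˣ := Additive.toMul y with hu
      have hy : y = Additive.ofMul u := by simp [hu]
      refine ⟨ADivisor.principal (u : F), Submodule.subset_span ?_, ?_, degF_principal F _, ?_⟩
      · exact principal_mem_APrc (NumberField.Units.coe_ne_zero u)
      · exact principal_coe_unit_apply_inr u
      · intro w
        rw [principal_coe_unit_apply_inl, neg_neg, hy]
        rfl
    | zero => exact ⟨0, Submodule.zero_mem _, fun _ => rfl, map_zero _, fun _ => by simp⟩
    | add x y _ _ hx hy =>
      obtain ⟨s, hs, hs1, hs2, hs3⟩ := hx
      obtain ⟨t, ht, ht1, ht2, ht3⟩ := hy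
      refine ⟨s + t, Submodule.add_mem _ hs ht, fun v => by simp [hs1 v, ht1 v],
        by rw [map_add, hs2, ht2, add_zero], fun w => ?_⟩
      simp only [Finsupp.add_apply, neg_add, hs3 w, ht3 w, Pi.add_apply]
    | smul c x _ hx =>
      obtain ⟨s, hs, hs1, hs2, hs3⟩ := hx
      refine ⟨c • s, Submodule.smul_mem _ c hs, fun v => by simp [hs1 v],
        by rw [map_smul, hs2, smul_zero], fun w => ?_⟩
      simp only [Finsupp.smul_apply, smul_eq_mul, Pi.smul_apply, ← hs3 w, mul_neg]
  obtain ⟨s, hs, hs1, hs2, hs3⟩ := key g hg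
  -- `a − s` has no nonarchimedean part, degree `0` and vanishes at every `w ≠ w₀`: it is `0`
  have hzero : a - s = 0 := by
    refine eq_zero_of_inr_eq_zero_of_degF_eq_zero (a - s) (fun v => by simp [ha v, hs1 v])
      (by rw [map_sub, hdeg, hs2, sub_zero]) fun w hw => ?_
    have := hs3 ⟨w, hw⟩
    simp only [g, neg_inj] at this
    simp [this]
  rw [sub_eq_zero] at hzero
  rwa [hzero]

/-! ### Main theorem -/

/-- **`ℝ`-span of the principal divisors = kernel of the degree** (inclusion `⊇`): every real
arithmetic divisor of degree `0` is an `ℝ`-linear combination of principal divisors `ADiv(f)`,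
`f ∈ F^×` ([FrdI] Thm. 6.4 (i): injectivity of `δ_A`, "a consequence of the well-known Dirichlet unit
theorem", p. 115 l. 28–32; the nonarchimedean part is removed by the finiteness of the class group).
[cite: MochizukiFrdI2008, Thm. 6.4 (i) p.115] -/
theorem mem_span_APrc_of_degF_eq_zero (a : ADivisor F) (hdeg : degF F a = 0) :
    a ∈ Submodule.span ℝ ((APrc F : AddSubgroup (ADivisor F)) : Set (ADivisor F)) := by
  classical
  set S := Submodule.span ℝ ((APrc F : AddSubgroup (ADivisor F)) : Set (ADivisor F)) with hS
  -- (A) every divisor is congruent modulo `S` to one with no nonarchimedean part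
  have hA : ∀ b : ADivisor F, ∃ b' s : ADivisor F, s ∈ S ∧ (∀ v, b' (Sum.inr v) = 0) ∧ b = b' + s := by
    intro b
    induction b using Finsupp.induction with
    | zero => exact ⟨0, 0, Submodule.zero_mem _, fun _ => rfl, by simp⟩
    | single_add p c b _ _ ih =>
      obtain ⟨b', s, hs, hb', rfl⟩ := ih
      rcases p with w | v
      · refine ⟨Finsupp.single (Sum.inl w) c + b', s, hs, fun v => by simp [hb' v], by abel⟩
      · obtain ⟨h, x, hh, hx0, hx⟩ := exists_principal_apply_inr_eq_single v
        have hx0' : (x : F) ≠ 0 := by exact_mod_cast hx0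
        refine ⟨(Finsupp.single (Sum.inr v) c - (c / h) • ADivisor.principal (x : F)) + b',
          (c / h) • ADivisor.principal (x : F) + s,
          Submodule.add_mem _ (Submodule.smul_mem _ _ (Submodule.subset_span (principal_mem_APrc hx0')))
            hs, fun v' => ?_, by abel⟩
        have hhR : (h : ℝ) ≠ 0 := by exact_mod_cast hh.ne'
        simp only [Finsupp.add_apply, Finsupp.sub_apply, Finsupp.smul_apply, hx v', hb' v',
          smul_eq_mul, add_zero, Finsupp.single_apply]
        by_cases hv' : v' = v
        · subst hv'
          rw [if_pos rfl, if_pos rfl]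
          field_simp
          ring
        · rw [if_neg (fun h' => hv' (Sum.inr_injective h').symm), if_neg hv', mul_zero, sub_zero]
  obtain ⟨a', s, hs, ha', rfl⟩ := hA a
  -- (B) the archimedean remainder has degree `0`, hence lies in `S` by the Dirichlet step
  have hsdeg : degF F s = 0 := by
    have hle : S ≤ LinearMap.ker (degF F) := by
      rw [hS, Submodule.span_le]
      intro t ht
      exact degF_eq_zero_of_mem_APrc ht
    exact hle hs
  have ha'deg : degF F a' = 0 := by
    rw [map_add, hsdeg, add_zero] at hdeg
    exact hdeg
  exact Submodule.add_mem _ (mem_span_APrc_of_inr_eq_zero a' ha' ha'deg) hs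

/-- **`span_ℝ APrc(F) = Ker(deg_F)`** in `ADiv_ℝ(F)`: "the image of `Φ^birat(L)` in
`(Φ^rlf_factor)^gp(L)` … is equal to the set of elements of finite support with arithmetic degree `0`"
([FrdI] Thm. 6.4 (i), proof p. 115 l. 28–32), realified. [cite: MochizukiFrdI2008, Thm. 6.4 (i) p.115] -/
theorem span_APrc_eq_ker_degF :
    Submodule.span ℝ ((APrc F : AddSubgroup (ADivisor F)) : Set (ADivisor F)) = LinearMap.ker (degF F) := by
  refine le_antisymm ?_ fun a ha => mem_span_APrc_of_degF_eq_zero a (LinearMap.mem_ker.mp ha)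
  rw [Submodule.span_le]
  intro t ht
  exact degF_eq_zero_of_mem_APrc ht

/-- Hence **`deg_F` induces `ADiv_ℝ(F) / span_ℝ APrc(F) ≅ ℝ`** — the realified content of
"`δ_A : Pic_Φ(A) ⥲ ℝ` is an isomorphism" ([FrdI] Thm. 6.4 (i) p. 114): the degree vanishes exactly on the
span of the principal divisors and is onto. [cite: MochizukiFrdI2008, Thm. 6.4 (i) p.114] -/
theorem degF_quotient_bijective :
    Function.Bijective
      ((Submodule.span ℝ ((APrc F : AddSubgroup (ADivisor F)) : Set (ADivisor F))).liftQ (degF F)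
        (span_APrc_eq_ker_degF (F := F)).le) := by
  constructor
  · rw [← LinearMap.ker_eq_bot, Submodule.ker_liftQ, span_APrc_eq_ker_degF, Submodule.mkQ_map_self]
  · rw [← LinearMap.range_eq_top, Submodule.range_liftQ, LinearMap.range_eq_top]
    exact degF_surjective F

end Literature.IUT.LogVolume

end
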